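import Literature.Geometry.Kaehler.CyclotomicTwentyOneHodgeConjecture
import HarnessLib

/-!
# `Φ₄₂`: complex tori with an endomorphism of characteristic polynomial `Φ₄₂ = Φ₂₁(−X)`, and `ℚ(ζ₄₂) = ℚ(ζ₂₁)` on the variety side

Layer `Literature/Geometry/Kaehler`, namespace `Literature.Geometry.Kaehler.ComplexTorus`; lane `lit-hodgefound`, prover seat `lit-hodgefound-p10`,
generation 34, row «A2-26 (Φ₄₂)» (self-proposed 2026-08-28); sequel of `CyclotomicTwentyOneHodgeConjecture` in the manner of generation 33's
`CyclotomicTwentySixHodgeConjecture` (`Φ₂₆ = Φ₁₃(−X)`).  Theorems only (no `def`, no named fact; net debt 0).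

If `u ∈ End X` has `P_u = Φ₄₂` then `−u ∈ End X` has `P_{−u} = Φ₂₁` (`21` odd: `Φ₄₂(X) = Φ₂₁(−X)`, §1), so §3 of the `ℚ(ζ₂₁)` file applies verbatim to
the complex `6`-tori with `P_u = Φ₄₂` (§2: `rank MT ∈ {7, 6}` for the simple ones, `Hdg = Div` on all powers iff `rank MT = 7`); and an
`IsCyclotomicExtension {42} ℚ K` is an `IsCyclotomicExtension {21} ℚ K` (§3), so the dichotomy for the CM abelian varieties of `ℚ(ζ₄₂)` is that of
`ℚ(ζ₂₁)`: Hodge conjecture with all powers, or a simple sixfold with `B³ ≠ D³` (Dodson's `24` degenerate primitive types).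

* §1 `cyclotomic_seven_int`, `cyclotomic_twentyOne_int` (`X¹² − X¹¹ + X⁹ − X⁸ + X⁶ − X⁴ + X³ − X + 1`, from `Φ₇(X³) = Φ₂₁ Φ₇`),
  `cyclotomic_fortyTwo_int` (`X¹² + X¹¹ − X⁹ − X⁸ + X⁶ − X⁴ − X³ + X + 1`, from `Φ₂₁(X²) = Φ₄₂ Φ₂₁`), `cyclotomic_twentyOne_comp_neg_X`,
  `cyclotomic_fortyTwo_comp_neg_X`, **`charpoly_neg_eq_cyclotomic_twentyOne_of_charpoly_eq_cyclotomic_fortyTwo`** (and conversely).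
* §2 **`IsSimple.mtRank_hodgeStructure_eq_seven_or_six_fortyTwo`**, **`forall_divisorClasses_powPeriod_eq_hodgeClasses_iff_of_isSimple_fortyTwo`**,
  `divisorClasses_powPeriod_eq_hodgeClasses_of_fortyTwo`, `exists_isSimple_mtRank_eq_six_and_seven_fortyTwo` (both cases occur).
* §3 `isCyclotomicExtension_twentyOne_of_fortyTwo`, **`hodgeConjectureFor_pow_or_exceptional_fortyTwo`** (the dichotomy), `exists_isSimple_exceptional_fortyTwo`.

## References

* [Washington1997] L. C. Washington, *Introduction to Cyclotomic Fields*, Ch. 2 (`Φ_{2n}(X) = Φ_n(−X)` for odd `n > 1`; `ℚ(ζ_{2n}) = ℚ(ζ_n)`).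
* [BirkenhakeLange2004] C. Birkenhake, H. Lange, *Complex Abelian Varieties*, §13.3 Cor. 13.3.4.
* [Dodson1984] B. Dodson, Trans. AMS 283 (1984), §3.1.0, Thm. 3.2.1.
* [Gordon1999HodgeAVSurvey] B. B. Gordon (1999), 5.13 (ii), Thm. 6.4, 7.5, §9.3.
-/

noncomputable section

open scoped Classical nonZeroDivisors NumberField Manifold ContDiff MatrixGroups
open NumberField Module Polynomial CategoryTheory CategoryTheory.Limits

namespace Literature.Geometry.Kaehler

namespace ComplexTorus

-- `open scoped`: the tree's action of `Aut(ℂ)` on `Hom(K, ℂ)` by composition (`ringEquivCompAction`) is a scoped instance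
open scoped Literature.NumberTheory.ComplexMultiplication
open Literature.AlgebraicGeometry.Motives (CMType AbelianVariety HodgeTensorFacts)
open Literature.AlgebraicGeometry.HodgeTheory (HodgeConjectureFor complexBetti)
open Literature.AlgebraicGeometry.VanGeemen1994 (hodgeClassSpan)
open Literature.Barriers.HodgeConjecture (divisorClassesSpan)
open Literature.NumberTheory.ComplexMultiplication (IsPrimitive)
open Literature.AlgebraicGeometry.ComplexMultiplication (IsCMTypeRealisation)
open Literature.NumberTheory.Automorphic.Arthur2013.Leaves.TECR.TorusDict (isCyclotomicExtension_of_two_mul_of_odd)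

/-! ### §1 `Φ₇`, `Φ₂₁`, `Φ₄₂` and `P_{−A}` -/

/-- **`Φ₇ = X⁶ + X⁵ + X⁴ + X³ + X² + X + 1`.** [cite: Washington1997, Ch. 2] -/
theorem cyclotomic_seven_int : cyclotomic 7 ℤ = X ^ 6 + X ^ 5 + X ^ 4 + X ^ 3 + X ^ 2 + X + 1 := by
  haveI : Fact (Nat.Prime 7) := ⟨by norm_num⟩
  rw [cyclotomic_prime ℤ 7]
  simp [Finset.sum_range_succ]
  ring

/-- **`Φ₂₁ = X¹² − X¹¹ + X⁹ − X⁸ + X⁶ − X⁴ + X³ − X + 1`** (from `Φ₇(X³) = Φ₂₁ Φ₇`). [cite: Washington1997, Ch. 2] -/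
theorem cyclotomic_twentyOne_int : cyclotomic 21 ℤ = X ^ 12 - X ^ 11 + X ^ 9 - X ^ 8 + X ^ 6 - X ^ 4 + X ^ 3 - X + 1 := by
  have h := cyclotomic_expand_eq_cyclotomic_mul Nat.prime_three (by norm_num : ¬ 3 ∣ 7) ℤ
  rw [show (7 * 3 : ℕ) = 21 by norm_num, cyclotomic_seven_int] at h
  have hexp : expand ℤ 3 (X ^ 6 + X ^ 5 + X ^ 4 + X ^ 3 + X ^ 2 + X + 1 : ℤ[X]) =
      X ^ 18 + X ^ 15 + X ^ 12 + X ^ 9 + X ^ 6 + X ^ 3 + 1 := by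
    simp [expand_X]
    ring
  rw [hexp] at h
  have hne : (X ^ 6 + X ^ 5 + X ^ 4 + X ^ 3 + X ^ 2 + X + 1 : ℤ[X]) ≠ 0 := by
    rw [← cyclotomic_seven_int]; exact cyclotomic_ne_zero 7 ℤ
  apply mul_right_cancel₀ hne
  rw [← h]
  ring

/-- **`Φ₄₂ = X¹² + X¹¹ − X⁹ − X⁸ + X⁶ − X⁴ − X³ + X + 1`** (from `Φ₂₁(X²) = Φ₄₂ Φ₂₁`). [cite: Washington1997, Ch. 2] -/
theorem cyclotomic_fortyTwo_int : cyclotomic 42 ℤ = X ^ 12 + X ^ 11 - X ^ 9 - X ^ 8 + X ^ 6 - X ^ 4 - X ^ 3 + X + 1 := by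
  have h := cyclotomic_expand_eq_cyclotomic_mul Nat.prime_two (by norm_num : ¬ 2 ∣ 21) ℤ
  rw [show (21 * 2 : ℕ) = 42 by norm_num, cyclotomic_twentyOne_int] at h
  have hexp : expand ℤ 2 (X ^ 12 - X ^ 11 + X ^ 9 - X ^ 8 + X ^ 6 - X ^ 4 + X ^ 3 - X + 1 : ℤ[X]) =
      X ^ 24 - X ^ 22 + X ^ 18 - X ^ 16 + X ^ 12 - X ^ 8 + X ^ 6 - X ^ 2 + 1 := by
    simp [expand_X]
    ring
  rw [hexp] at h
  have hne : (X ^ 12 - X ^ 11 + X ^ 9 - X ^ 8 + X ^ 6 - X ^ 4 + X ^ 3 - X + 1 : ℤ[X]) ≠ 0 := by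
    rw [← cyclotomic_twentyOne_int]; exact cyclotomic_ne_zero 21 ℤ
  apply mul_right_cancel₀ hne
  rw [← h]
  ring

/-- **`Φ₂₁(−X) = Φ₄₂`.** [cite: Washington1997, Ch. 2] -/
theorem cyclotomic_twentyOne_comp_neg_X : (cyclotomic 21 ℤ).comp (-X) = cyclotomic 42 ℤ := by
  rw [cyclotomic_twentyOne_int, cyclotomic_fortyTwo_int]
  simp [sub_comp, add_comp]
  ring

section MatrixAlgebra

variable {ι : Type} [Fintype ι] [DecidableEq ι]

/-- The minimal-polynomial argument (`Φ_n(−A) = Φ_m(A) = 0`, `Φ_n` irreducible, degrees). [cite: Washington1997, Ch. 2] [cite: BirkenhakeLange2004, §13.3 Cor. 13.3.4] -/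
private theorem charpoly_neg_eq_cyclotomic_of_comp_neg_X₆₂ {m n : ℕ} (hm : 0 < m) (hn : 0 < n)
    (hcomp : (cyclotomic n ℤ).comp (-X) = cyclotomic m ℤ) (htot : Nat.totient n = Nat.totient m) {A : Matrix ι ι ℤ}
    (hP : A.charpoly = cyclotomic m ℤ) : (-A).charpoly = cyclotomic n ℤ := by
  have hcard : Fintype.card ι = Nat.totient m := by
    rw [← Matrix.charpoly_natDegree_eq_dim A, hP, natDegree_cyclotomic]
  have hpos : 0 < Fintype.card ι := by rw [hcard]; exact Nat.totient_pos.2 hm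
  haveI : Nonempty ι := Fintype.card_pos_iff.1 hpos
  set F : Matrix ι ι ℤ →+* Matrix ι ι ℚ := (Int.castRingHom ℚ).mapMatrix with hF
  have hB : (F A).charpoly = cyclotomic m ℚ := by
    rw [hF, RingHom.mapMatrix_apply, Matrix.charpoly_map, hP, map_cyclotomic_int]
  have haeval : aeval (-(F A)) (cyclotomic n ℚ) = 0 := by
    have h1 : aeval (F A) (cyclotomic m ℚ) = 0 := by rw [← hB]; exact Matrix.aeval_self_charpoly _
    have h2 : (cyclotomic n ℚ).comp (-X) = cyclotomic m ℚ := by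
      rw [← map_cyclotomic_int n ℚ, ← map_cyclotomic_int m ℚ, ← hcomp, Polynomial.map_comp]
      simp
    rw [← h2, aeval_comp] at h1
    simpa using h1
  have hmin : minpoly ℚ (-(F A)) = cyclotomic n ℚ :=
    (minpoly.eq_of_irreducible_of_monic (cyclotomic.irreducible_rat hn) haeval (cyclotomic.monic n ℚ)).symm
  have hdvd : cyclotomic n ℚ ∣ (-(F A)).charpoly := hmin ▸ Matrix.minpoly_dvd_charpoly _
  have hQ : (-(F A)).charpoly = cyclotomic n ℚ := by
    refine eq_of_monic_of_dvd_of_natDegree_le (cyclotomic.monic _ ℚ) (Matrix.charpoly_monic _) hdvd ?_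
    rw [Matrix.charpoly_natDegree_eq_dim, natDegree_cyclotomic, hcard, htot]
  apply Polynomial.map_injective (Int.castRingHom ℚ) (Int.castRingHom ℚ).injective_int
  rw [map_cyclotomic_int, ← Matrix.charpoly_map, ← hQ, ← map_neg F A, hF, RingHom.mapMatrix_apply]

/-- **`Φ₄₂(−X) = Φ₂₁`.** [cite: Washington1997, Ch. 2] -/
theorem cyclotomic_fortyTwo_comp_neg_X : (cyclotomic 42 ℤ).comp (-X) = cyclotomic 21 ℤ := by
  rw [cyclotomic_twentyOne_int, cyclotomic_fortyTwo_int]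
  simp [sub_comp, add_comp]
  ring

/-- **`P_A = Φ₄₂ ⟹ P_{−A} = Φ₂₁`** for an integer matrix `A` (of size `12`). [cite: BirkenhakeLange2004, §13.3 Cor. 13.3.4] [cite: Washington1997, Ch. 2] -/
theorem charpoly_neg_eq_cyclotomic_twentyOne_of_charpoly_eq_cyclotomic_fortyTwo {A : Matrix ι ι ℤ}
    (hP : A.charpoly = cyclotomic 42 ℤ) : (-A).charpoly = cyclotomic 21 ℤ :=
  charpoly_neg_eq_cyclotomic_of_comp_neg_X₆₂ (by norm_num) (by norm_num) cyclotomic_twentyOne_comp_neg_X (by decide) hP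

/-- **`P_A = Φ₂₁ ⟹ P_{−A} = Φ₄₂`.** [cite: BirkenhakeLange2004, §13.3 Cor. 13.3.4] [cite: Washington1997, Ch. 2] -/
theorem charpoly_neg_eq_cyclotomic_fortyTwo_of_charpoly_eq_cyclotomic_twentyOne {A : Matrix ι ι ℤ}
    (hP : A.charpoly = cyclotomic 21 ℤ) : (-A).charpoly = cyclotomic 42 ℤ :=
  charpoly_neg_eq_cyclotomic_of_comp_neg_X₆₂ (by norm_num) (by norm_num) cyclotomic_fortyTwo_comp_neg_X (by decide) hP

end MatrixAlgebra

/-! ### §2 Complex tori with `P_u = Φ₄₂` -/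

section Tori

variable {ι : Type} [Fintype ι] [DecidableEq ι] {E : Type} [NormedAddCommGroup E] [NormedSpace ℂ E] {P : (ι → ℝ) ≃L[ℝ] E}

/-- **`rank MT(X) ∈ {7, 6}` FOR A SIMPLE COMPLEX TORUS WITH AN ENDOMORPHISM OF CHARACTERISTIC POLYNOMIAL `Φ₄₂`** (through `−u`, `P_{−u} = Φ₂₁`).
[cite: Dodson1984, §3.1.0 and Thm. 3.2.1] [cite: BirkenhakeLange2004, §13.3] -/
theorem IsSimple.mtRank_hodgeStructure_eq_seven_or_six_fortyTwo [HodgeTensorFacts.{0, 0}] (hX : ComplexTorus.IsSimple P)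
    {A : Matrix ι ι ℤ} (hA : A ∈ endRingInt P) (hP : A.charpoly = cyclotomic 42 ℤ) :
    (hodgeStructure P 1).mtRank = 7 ∨ (hodgeStructure P 1).mtRank = 6 :=
  hX.mtRank_hodgeStructure_eq_seven_or_six_twentyOne ((endRingInt P).neg_mem hA)
    (charpoly_neg_eq_cyclotomic_twentyOne_of_charpoly_eq_cyclotomic_fortyTwo hP)

/-- **FOR A SIMPLE `X` WITH `P_u = Φ₄₂`: `Hdg(Xᵏ) = Div(Xᵏ)` FOR ALL `k` ⟺ `rank MT(X) = 7`.** [cite: Gordon1999HodgeAVSurvey, 7.5 and §9.3] -/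
theorem forall_divisorClasses_powPeriod_eq_hodgeClasses_iff_of_isSimple_fortyTwo [HodgeTensorFacts.{0, 0}] (hX : ComplexTorus.IsSimple P)
    {A : Matrix ι ι ℤ} (hA : A ∈ endRingInt P) (hP : A.charpoly = cyclotomic 42 ℤ) :
    (∀ k p : ℕ, divisorClasses (powPeriod P k) p = hodgeClasses (powPeriod P k) p) ↔ (hodgeStructure P 1).mtRank = 7 :=
  forall_divisorClasses_powPeriod_eq_hodgeClasses_iff_of_isSimple_twentyOne hX ((endRingInt P).neg_mem hA)
    (charpoly_neg_eq_cyclotomic_twentyOne_of_charpoly_eq_cyclotomic_fortyTwo hP)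

/-- **`Hdg(Xᵏ) = Div(Xᵏ)` FOR ALL `k` WHEN `X` (WITH `P_u = Φ₄₂`) IS NOT SIMPLE OR HAS `rank MT(X) = 7`.** [cite: MoonenZarhin1999LowDim, §2 Thm. (2.7)]
[cite: Gordon1999HodgeAVSurvey, 7.5] -/
theorem divisorClasses_powPeriod_eq_hodgeClasses_of_fortyTwo [HodgeTensorFacts.{0, 0}] {A : Matrix ι ι ℤ} (hA : A ∈ endRingInt P)
    (hP : A.charpoly = cyclotomic 42 ℤ) (h : ComplexTorus.IsSimple P → (hodgeStructure P 1).mtRank = 7) (k p : ℕ) :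
    divisorClasses (powPeriod P k) p = hodgeClasses (powPeriod P k) p :=
  divisorClasses_powPeriod_eq_hodgeClasses_of_twentyOne ((endRingInt P).neg_mem hA)
    (charpoly_neg_eq_cyclotomic_twentyOne_of_charpoly_eq_cyclotomic_fortyTwo hP) h k p

open Literature.NumberTheory.ComplexMultiplication.CMTypeLattice (periodIso) in
/-- **Both cases occur with `P_u = Φ₄₂`** (`u = −ζ₂₁` on the models `ℂ⁶/Φ(𝔞)` of the `ℚ(ζ₂₁)` file): simple abelian `6`-folds with an
endomorphism of characteristic polynomial `Φ₄₂`, of `rank MT = 6` with `Hdg ≠ Div` on some power, and of `rank MT = 7` with `Hdg = Div` on all powers.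
[cite: Dodson1984, Thm. 3.2.1] [cite: Shimura1998, §6.2 Thm. 3] -/
theorem exists_isSimple_mtRank_eq_six_and_seven_fortyTwo [HodgeTensorFacts.{0, 0}] :
    (∃ Φ : CMType (CyclotomicField 21 ℚ), ∀ I : (FractionalIdeal (𝓞 (CyclotomicField 21 ℚ))⁰ (CyclotomicField 21 ℚ))ˣ,
      ComplexTorus.IsSimple (periodIso Φ I) ∧ IsAbelianVariety (periodIso Φ I) ∧
      (∃ A ∈ endRingInt (periodIso Φ I), A.charpoly = cyclotomic 42 ℤ) ∧
      (hodgeStructure (periodIso Φ I) 1).mtRank = 6 ∧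
      ¬ ∀ k p : ℕ, divisorClasses (powPeriod (periodIso Φ I) k) p = hodgeClasses (powPeriod (periodIso Φ I) k) p) ∧
    (∃ Φ : CMType (CyclotomicField 21 ℚ), ∀ I : (FractionalIdeal (𝓞 (CyclotomicField 21 ℚ))⁰ (CyclotomicField 21 ℚ))ˣ,
      ComplexTorus.IsSimple (periodIso Φ I) ∧ IsAbelianVariety (periodIso Φ I) ∧
      (∃ A ∈ endRingInt (periodIso Φ I), A.charpoly = cyclotomic 42 ℤ) ∧
      (hodgeStructure (periodIso Φ I) 1).mtRank = 7 ∧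
      ∀ k p : ℕ, divisorClasses (powPeriod (periodIso Φ I) k) p = hodgeClasses (powPeriod (periodIso Φ I) k) p) := by
  obtain ⟨⟨Φ, hΦ⟩, ⟨Ψ, hΨ⟩⟩ := exists_isSimple_mtRank_eq_six_and_seven_twentyOne
  have hneg : ∀ (Θ : CMType (CyclotomicField 21 ℚ)) (I : (FractionalIdeal (𝓞 (CyclotomicField 21 ℚ))⁰ (CyclotomicField 21 ℚ))ˣ),
      (∃ A ∈ endRingInt (periodIso Θ I), A.charpoly = cyclotomic 21 ℤ) →
        ∃ A ∈ endRingInt (periodIso Θ I), A.charpoly = cyclotomic 42 ℤ := by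
    rintro Θ I ⟨A, hA, hP⟩
    exact ⟨-A, (endRingInt _).neg_mem hA, charpoly_neg_eq_cyclotomic_fortyTwo_of_charpoly_eq_cyclotomic_twentyOne hP⟩
  exact ⟨⟨Φ, fun I ↦ ⟨(hΦ I).1, (hΦ I).2.1, hneg Φ I (hΦ I).2.2.1, (hΦ I).2.2.2⟩⟩,
    ⟨Ψ, fun I ↦ ⟨(hΨ I).1, (hΨ I).2.1, hneg Ψ I (hΨ I).2.2.1, (hΨ I).2.2.2⟩⟩⟩

end Tori

/-! ### §3 Abelian varieties with complex multiplication by `ℚ(ζ₄₂) = ℚ(ζ₂₁)` -/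

section Varieties

variable {K : Type} [Field K] [NumberField K]
  {A : AbelianVariety ℂ} {ι : 𝓞 K →+* End A} {θ : K →+* Module.End ℂ (complexBetti A.X 1)}

/-- `ℚ(ζ₄₂) = ℚ(ζ₂₁)`. [cite: Washington1997, Ch. 2] [folklore] -/
theorem isCyclotomicExtension_twentyOne_of_fortyTwo (hK : IsCyclotomicExtension {42} ℚ K) : IsCyclotomicExtension {21} ℚ K := by
  haveI : IsCyclotomicExtension {2 * 21} ℚ K := hK
  exact isCyclotomicExtension_of_two_mul_of_odd (K := K) (by decide)

/-- **THE DICHOTOMY FOR THE CM ABELIAN VARIETIES OF `ℚ(ζ₄₂)`** (`= ℚ(ζ₂₁)`; any CM type): EITHER `B•(Aⁿ) ⊗ ℂ = D•(Aⁿ) ⊗ ℂ` and the Hodge conjecture for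
every power of `A`, OR `A` is a simple sixfold with `B³(A) ⊗ ℂ ≠ D³(A) ⊗ ℂ` (its type, read on `ζ₂₁`-exponents, is primitive and coset-balanced
for `{1,4,10,13,16,19}` or `{1,2,4,8,11,16}`: `CyclotomicTwentyOneHodgeConjecture`). [cite: Dodson1984, Thm. 3.2.1] [cite: Gordon1999HodgeAVSurvey, Thm. 6.4, §9.3, 5.13 (ii)] -/
theorem hodgeConjectureFor_pow_or_exceptional_fortyTwo (hK : IsCyclotomicExtension {42} ℚ K) (Φ : CMType K) (hA : IsCMTypeRealisation Φ A ι θ) :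
    ((∀ n m : ℕ, hodgeClassSpan (⨁ fun _ : Fin n => A).dim (⨁ fun _ : Fin n => A).X m =
        divisorClassesSpan (⨁ fun _ : Fin n => A).X (⨁ fun _ : Fin n => A).dim m) ∧
      ∀ n : ℕ, HodgeConjectureFor (⨁ fun _ : Fin n => A).dim (⨁ fun _ : Fin n => A).X) ∨
    (A.IsSimple ∧ A.dim = 6 ∧ hodgeClassSpan 6 A.X 3 ≠ divisorClassesSpan A.X 6 3) := by
  have hK' := isCyclotomicExtension_twentyOne_of_fortyTwo hK
  haveI := hK'
  obtain ⟨φ₀⟩ : Nonempty (K →+* ℂ) := inferInstance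
  rcases hodgeConjectureFor_pow_or_exceptional_twentyOne hK' Φ φ₀ hA with h | ⟨-, -, hS, hd, hne⟩
  · exact Or.inl h
  · exact Or.inr ⟨hS, hd, hne⟩

/-- **Both branches occur for `ℚ(ζ₄₂)`**: there is a simple CM abelian sixfold by `𝓞_{ℚ(ζ₄₂)}` with `B³ ≠ D³`, and one all of whose powers satisfy the
Hodge conjecture. [cite: Shimura1998, §6.2 Thm. 3] [cite: Dodson1984, Thm. 3.2.1] -/
theorem exists_isSimple_exceptional_fortyTwo [hK : IsCyclotomicExtension {42} ℚ K] :
    (∃ (Φ : CMType K) (A : AbelianVariety ℂ) (ι' : 𝓞 K →+* End A) (θ' : K →+* Module.End ℂ (complexBetti A.X 1)),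
      IsCMTypeRealisation Φ A ι' θ' ∧ A.IsSimple ∧ A.dim = 6 ∧ hodgeClassSpan 6 A.X 3 ≠ divisorClassesSpan A.X 6 3) ∧
    (∃ (Φ : CMType K) (A : AbelianVariety ℂ) (ι' : 𝓞 K →+* End A) (θ' : K →+* Module.End ℂ (complexBetti A.X 1)),
      IsCMTypeRealisation Φ A ι' θ' ∧ A.IsSimple ∧ A.dim = 6 ∧
        ∀ n : ℕ, HodgeConjectureFor (⨁ fun _ : Fin n => A).dim (⨁ fun _ : Fin n => A).X) := by
  haveI := isCyclotomicExtension_twentyOne_of_fortyTwo hK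
  exact exists_isSimple_exceptional_twentyOne K

end Varieties

end ComplexTorus

end Literature.Geometry.Kaehler

end
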